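import Summits.CriticalPhenomena.CardyFormulaZ2.Theorems.DyadicBetaRigidityDyadicLatticeBetaLawOfComparison
import Summits.CriticalPhenomena.CardyFormulaZ2.Theorems.DyadicLatticeBetaLaw.Negative.DyadicLatticeBetaLawFalseWithoutUniformizing
import Literature.Probability.RandomPlanarGeometry.ConformalRectangleProofs

/-!
# S1 gives dyadic subsequential conformal invariance

Crux `DyadicLatticeBetaLaw` (stmt-CriticalPhenomena-18183, route `DyadicBetaRigidity` of
`CardyFormulaZ2`), line `Sketch` (idea `equimodular-comparison`). The line proves
`crux ⟸ S1 ∧ CardyRigiditySeq`, where S1 is the equicontinuous equimodular comparison of lattice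
polygons along the dyadic ladders (the open hard stub). This file records the registered support
stub `stub_dyadicSubseqCI_of_S1`: S1 ALONE (no rigidity) already yields DYADIC SUBSEQUENTIAL
CONFORMAL INVARIANCE — along every strictly increasing `κ : ℕ → ℕ` there is a further subsequence
`κ ∘ σ` and a law `f`, continuous and self-dual on `(0,1)`, such that the bond-`ℤ²` crossing
probability of EVERY conformal rectangle at mesh `1/2^(κ (σ n))` converges to `f` of its modulus.

Proof (the construction `hall` inside the landed composition `crux_of_comparison_of_rigiditySeq`,
minus the rigidity step). Take the unit square `R₀ = (0,1)²` with its corners marked, a lattice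
polygon of `ℤ²` at mesh `1` (`Negative.unitSquare_isLatticePolygon`), and a uniformizing datum
`(φ₀, x₀)` (`MarkedDomain.exists_isUniformizing_holds`). By compactness of `[0,1]` the sequence
`P[R₀, 1/2^(κ n)]` has a convergent subsequence `κ ∘ ψ'` with limit `p`. The landed stub S5b
`stub_clusterLawOfComparison` (fed by S1 and the landed S5a `stub_rectSubseqLimits`) passes a
continuous self-dual law `f` through `p` along a further subsequence `κ ∘ ψ' ∘ σ`, with convergence
of every lattice polygon at every dyadic mesh; the landed S2 `stub_subseqSandwich` upgrades this to
two one-sided eventual bounds for every conformal rectangle, and self-duality of `f` closes the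
sandwich (`tendsto_of_sandwich'`).

References: B. Bollobás, O. Riordan, *Percolation* (2006), Ch. 7 §7.1; S. Smirnov, C. R. Acad.
Sci. Paris 333 (2001), Thm 1 (conformal invariance of the scaling limit of crossing probabilities).
-/

noncomputable section

open MeasureTheory Filter Set Metric Topology
open UpperHalfPlane (upperHalfPlaneSet)
open Literature.Probability.RandomPlanarGeometry Literature.Probability.LatticeModels
open Literature.Probability.Percolation

namespace Summit.CriticalPhenomena.CardyFormulaZ2.Cruxes.DyadicLatticeBetaLaw.Stubs

/-- **S1 implies dyadic subsequential conformal invariance** (registered support stub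
`stub_dyadicSubseqCI_of_S1` of crux stmt-CriticalPhenomena-18183, line `Sketch`). If lattice
polygons with close moduli have eventually close bond-`ℤ²` crossing probabilities along their dyadic
ladders (S1, stated inline), then every strictly increasing `κ : ℕ → ℕ` has a subsequence `κ ∘ σ`
and a law `f : ℝ → ℝ`, continuous on `(0,1)` with `f (1 - η) = 1 - f η`, such that for every
conformal rectangle `R` with uniformizing datum `(φ, x)`,
`bondDomainCrossingProb R (1/2^(κ (σ n))) ⟶ f (crossRatio x)`: compactness of `[0,1]` on the unit
square's dyadic sequence, then S5b (`stub_clusterLawOfComparison`, with S5a `stub_rectSubseqLimits`)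
and S2 (`stub_subseqSandwich`). [cite: BollobasRiordan2006, Ch. 7 §7.1] -/
theorem stub_dyadicSubseqCI_of_S1 :
    (∀ ε : ℝ, 0 < ε → ∀ η ∈ Set.Ioo (0 : ℝ) 1, ∃ θ : ℝ, 0 < θ ∧
      ∀ h h' : ℝ, 0 < h → 0 < h' → ∀ R R' : ConformalRectangle,
        (∃ S : Finset (ℂ × ℂ), (∀ p ∈ S, ∃ u v : Site 2, (zdGraph 2).Adj u v ∧
            p.1 = meshPoint h u ∧ p.2 = meshPoint h v) ∧
            frontier R.carrier ⊆ ⋃ p ∈ S, segment ℝ p.1 p.2) →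
        (∃ S : Finset (ℂ × ℂ), (∀ p ∈ S, ∃ u v : Site 2, (zdGraph 2).Adj u v ∧
            p.1 = meshPoint h' u ∧ p.2 = meshPoint h' v) ∧
            frontier R'.carrier ⊆ ⋃ p ∈ S, segment ℝ p.1 p.2) →
        ∀ (φ : ConformalEquiv upperHalfPlaneSet R.carrier) (x : Fin 4 → ℝ)
          (φ' : ConformalEquiv upperHalfPlaneSet R'.carrier) (x' : Fin 4 → ℝ),
          R.IsUniformizing φ x → R'.IsUniformizing φ' x' →
          |crossRatio x - η| < θ → |crossRatio x' - η| < θ →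
          ∀ᶠ k : ℕ in atTop,
            |bondDomainCrossingProb R (h / 2 ^ k) - bondDomainCrossingProb R' (h' / 2 ^ k)| < ε) →
    ∀ κ : ℕ → ℕ, StrictMono κ → ∃ σ : ℕ → ℕ, StrictMono σ ∧ ∃ f : ℝ → ℝ,
      ContinuousOn f (Set.Ioo 0 1) ∧ (∀ η ∈ Set.Ioo (0 : ℝ) 1, f (1 - η) = 1 - f η) ∧
      ∀ (R : ConformalRectangle) (φ : ConformalEquiv upperHalfPlaneSet R.carrier) (x : Fin 4 → ℝ),
        R.IsUniformizing φ x →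
        Tendsto (fun n : ℕ => bondDomainCrossingProb R (1 / 2 ^ (κ (σ n)))) atTop
          (𝓝 (f (crossRatio x))) := by
  intro hS1 κ hκ
  -- the unit square `(0,1)²`, a lattice polygon of `ℤ²` at mesh `1`, with a uniformizing datum
  obtain ⟨φ₀, x₀, hφ₀⟩ :=
    MarkedDomain.exists_isUniformizing_holds (rectQuad 0 1 0 1 zero_lt_one zero_lt_one)
  -- a convergent subsequence of its dyadic crossing sequence along `κ` (compactness of `[0,1]`)
  obtain ⟨p, -, ψ', hψ', hp⟩ := isCompact_Icc.tendsto_subseq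
    (x := fun n =>
      bondDomainCrossingProb (rectQuad 0 1 0 1 zero_lt_one zero_lt_one) (1 / 2 ^ (κ n)))
    (fun n => bondDomainCrossingProb_mem_Icc _ _)
  have hκψ : StrictMono fun n => κ (ψ' n) := hκ.comp hψ'
  have hpκ : Tendsto (fun n => bondDomainCrossingProb (rectQuad 0 1 0 1 zero_lt_one zero_lt_one)
      (1 / 2 ^ (κ (ψ' n)))) atTop (𝓝 p) := hp
  -- S5b (with S1, S5a): a continuous self-dual law `f` through the cluster point `p`
  obtain ⟨σ, hσ, f, hfc, hfs, -, hlaw⟩ :=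
    stub_clusterLawOfComparison hS1 stub_rectSubseqLimits 1 one_pos
      (rectQuad 0 1 0 1 zero_lt_one zero_lt_one)
      Theorems.DyadicLatticeBetaLaw.Negative.unitSquare_isLatticePolygon
      φ₀ x₀ hφ₀ (fun n => κ (ψ' n)) hκψ p hpκ
  have hκσ : StrictMono fun n => κ (ψ' (σ n)) := hκψ.comp hσ
  refine ⟨fun n => ψ' (σ n), hψ'.comp hσ, f, hfc, hfs, ?_⟩
  -- S2: every conformal rectangle converges along `1/2^(κ (ψ' (σ n)))` to `f` of its modulus
  intro R φ x hφ
  have hη : crossRatio x ∈ Set.Ioo (0 : ℝ) 1 :=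
    ConformalRectangle.crossRatio_mem_Ioo_of_isUniformizing hφ
  have hsymm : 1 - f (1 - crossRatio x) = f (crossRatio x) := by
    rw [hfs _ hη]; ring
  exact tendsto_of_sandwich' hsymm
    (stub_subseqSandwich (fun n => κ (ψ' (σ n))) f hκσ hfc hlaw R φ x hφ)

end Summit.CriticalPhenomena.CardyFormulaZ2.Cruxes.DyadicLatticeBetaLaw.Stubs

end
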